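import Mathlib
import Literature.NumberTheory.Transcendental.ManyCurvePeriods
import Literature.NumberTheory.EllipticCurves.Uniformization
import Literature.ModelTheory.ExponentialFields.Semialgebraic

/-!
# Sketch — crux-ideate stmt-KontsevichZagierPeriods-18265 (`AlgebraicModuliRealPeriodCell`), ideator 1, round 1

First lemmas of the three idea cards (they must ELABORATE; two of them are proved here as the
cards' own cheapest falsifiers):

* card `conjugation-symmetrised-multipliers`: `conjSymm_multiplier` (PROVED), `cm_imaginary_multiplier` (PROVED);
* card `tarski-transfer-real-datum`: `tarskiDatum` (statement), `realDatum_of_real_multiplier` (statement),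
  and the combined target `AlgRealDatum` the two cards deliver to `stub_algNormalForm`;
* card `laurent-suplattice-descent`: `suplattice_isAlgebraic` (statement), `multiplier_isAlgebraic` (statement).
-/

noncomputable section

open Complex Polynomial
open scoped ComplexConjugate
open Literature.NumberTheory.Transcendental

namespace Summit.KontsevichZagierPeriods.KontsevichZagierPeriods.Cruxes.AlgebraicModuliRealPeriodCell.Ideator1

/-! ### Card `conjugation-symmetrised-multipliers` -/

/-- Conjugating a multiplier between two REAL lattices gives a multiplier. -/
theorem conj_multiplier {L L' : PeriodPair} (hL : L.IsReal) (hL' : L'.IsReal) {α : ℂ}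
    (hα : ∀ l ∈ L.lattice, α * l ∈ L'.lattice) : ∀ l ∈ L.lattice, conj α * l ∈ L'.lattice := by
  intro l hl
  have h1 : α * conj l ∈ L'.lattice := hα _ (hL l hl)
  have h2 := hL' _ h1
  simpa [map_mul] using h2

/-- **First lemma of card `conjugation-symmetrised-multipliers` (PROVED).** If two real lattices are
isogenous (some `α ≠ 0` with `αΛ ⊆ Λ'`), then `α + ᾱ = 2 Re α` and `α − ᾱ = 2i Im α` are multipliers too,
and one of them is non-zero: there is a REAL `ν ≠ 0` with `νΛ ⊆ Λ'` (a real isogeny `E → E'`) or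
`iνΛ ⊆ Λ'` (a real isogeny `E → E'⁻` to the `(−1)`-twist, whose lattice is `i⁻¹Λ'`). No case analysis
CM / non-CM, no Galois descent on `Hom`. -/
theorem conjSymm_multiplier (L L' : PeriodPair) (hL : L.IsReal) (hL' : L'.IsReal)
    (h : L.IsIsogenousTo L') :
    ∃ ν : ℝ, ν ≠ 0 ∧ ((∀ l ∈ L.lattice, (ν : ℂ) * l ∈ L'.lattice) ∨
      (∀ l ∈ L.lattice, (ν : ℂ) * I * l ∈ L'.lattice)) := by
  obtain ⟨α, hα0, hα⟩ := h
  have hc := conj_multiplier hL hL' hα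
  by_cases hre : α.re = 0
  · have him : α.im ≠ 0 := by
      intro him
      apply hα0
      exact Complex.ext (by simpa using hre) (by simpa using him)
    refine ⟨2 * α.im, by positivity, Or.inr fun l hl => ?_⟩
    have hsub : (α - conj α) * l ∈ L'.lattice := by
      rw [sub_mul]
      exact sub_mem (hα l hl) (hc l hl)
    have key : ((2 * α.im : ℝ) : ℂ) * I = α - conj α := by
      rw [Complex.sub_conj]
    rw [key]
    exact hsub
  · refine ⟨2 * α.re, by positivity, Or.inl fun l hl => ?_⟩
    have hadd : (α + conj α) * l ∈ L'.lattice := by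
      rw [add_mul]
      exact add_mem (hα l hl) (hc l hl)
    have key : ((2 * α.re : ℝ) : ℂ) = α + conj α := by
      rw [Complex.add_conj]
    rw [key]
    exact hadd

/-- A REAL multiplier of a lattice into itself is an integer (matrix `diag(α, α)` in the basis). -/
theorem multiplier_real_int (L : PeriodPair) {α : ℂ} (hreal : α.im = 0)
    (hα : ∀ l ∈ L.lattice, α * l ∈ L.lattice) : ∃ n : ℤ, α = n := by
  obtain ⟨a, b, hab⟩ := PeriodPair.mem_lattice.1 (hα _ L.ω₁_mem_lattice)
  -- `(α - a) ω₁ - b ω₂ = 0` with real coefficients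
  have hre : α = (α.re : ℂ) := by
    apply Complex.ext <;> simp [hreal]
  have h0 : ((α.re - a : ℝ) : ℂ) * L.ω₁ + ((-b : ℝ) : ℂ) * L.ω₂ = 0 := by
    push_cast
    have := hab
    rw [hre] at this
    linear_combination -this
  have hind := LinearIndependent.pair_iff.mp L.indep (α.re - a) (-b) (by
    simpa [Matrix.cons_val_zero, Matrix.cons_val_one, Matrix.head_cons, smul_eq_mul] using h0)
  refine ⟨a, ?_⟩
  rw [hre]
  have : α.re = a := by linarith [hind.1]
  rw [this]
  simp

/-- **CM edge (PROVED).** A real lattice with complex multiplication has a PURELY IMAGINARY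
multiplier `iν`, `ν ∈ ℝ ∖ 0` (namely `α − ᾱ` for any non-integral multiplier `α`): the real isogeny
`E → E⁻` onto the `(−1)`-twist (e.g. `√−3` on `y² = x³ + 1`, calibration `Ω(x³+1) = √3·Ω(x³−1)`). -/
theorem cm_imaginary_multiplier (L : PeriodPair) (hL : L.IsReal) (h : L.HasCM) :
    ∃ ν : ℝ, ν ≠ 0 ∧ ∀ l ∈ L.lattice, (ν : ℂ) * I * l ∈ L.lattice := by
  obtain ⟨α, hαn, hα⟩ := h
  have hc := conj_multiplier hL hL hα
  have him : α.im ≠ 0 := by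
    intro him
    obtain ⟨n, hn⟩ := multiplier_real_int L him hα
    exact hαn n hn
  refine ⟨2 * α.im, by positivity, fun l hl => ?_⟩
  have hsub : (α - conj α) * l ∈ L.lattice := by
    rw [sub_mul]
    exact sub_mem (hα l hl) (hc l hl)
  have key : ((2 * α.im : ℝ) : ℂ) * I = α - conj α := by
    rw [Complex.sub_conj]
  rw [key]
  exact hsub

/-! ### Card `tarski-transfer-real-datum` -/

/-- The x-rational isogeny DATUM of the route, over `ℝ` (curves `y² = x³ + αx + β → y² = x³ + α'x + β'`):
Wronskian `W = f'g − fg' ≠ 0` and `c²·g·(f³ + α'fg² + β'g³) = (X³ + αX + β)·W²`. -/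
def IsRealDatum (α β α' β' : ℝ) (f g : ℝ[X]) (c : ℝ) : Prop :=
  derivative f * g - f * derivative g ≠ 0 ∧
    C (c ^ 2) * g * (f ^ 3 + C α' * f * g ^ 2 + C β' * g ^ 3) =
      (X ^ 3 + C α * X + C β) * (derivative f * g - f * derivative g) ^ 2

/-- **First lemma of card `tarski-transfer-real-datum`** (`ℝ_alg ≺ ℝ`, existential case, for the datum):
if the two cubics have real-ALGEBRAIC coefficients and a REAL datum of some degree exists, then a real
datum with ALGEBRAIC coefficients (and algebraic multiplier `c`) exists. Proof plan: the set of
coefficient vectors `(f, g, c) ∈ ℝ^{2(N+1)+1}` of data of degree `≤ N` is semialgebraic over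
`ℝ_alg` (coefficientwise polynomial identities with parameters `α, β, α', β'`; `W ≠ 0` = some coefficient
`≠ 0`), hence over `ℚ` (`DefinableMoves.algebraicCoefficients_proof`), and non-empty, so it has an
algebraic point (`DefinableMoves.algebraicPoints_proof`). -/
theorem tarskiDatum (α β α' β' : ℝ) (hα : IsAlgebraic ℚ α) (hβ : IsAlgebraic ℚ β)
    (hα' : IsAlgebraic ℚ α') (hβ' : IsAlgebraic ℚ β')
    (h : ∃ (f g : ℝ[X]) (c : ℝ), IsRealDatum α β α' β' f g c) :
    ∃ (f g : ℝ[X]) (c : ℝ), (∀ i, IsAlgebraic ℚ (f.coeff i)) ∧ (∀ i, IsAlgebraic ℚ (g.coeff i)) ∧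
      IsAlgebraic ℚ c ∧ IsRealDatum α β α' β' f g c := by
  sorry

/-- **Non-emptiness over `ℝ`** (analytic input, from the LANDED complex transformation theory): a REAL
multiplier `ν` between the period lattices (`g₂ = −4α`, `g₃ = −4β`, normalisation `℘ = x`) yields a real
datum `E → E'`: `Λ ⊆ ν⁻¹Λ'` has REAL invariants `ν⁴g₂', ν⁶g₃'`, the transformation identity
(`PeriodPair.transformation_polynomial_identity`) gives `T = P/Q ∈ ℂ(X)`, complex conjugation fixes the
four invariants so `T̄ = T` (`PeriodPair.map_mul_eq_mul_map_of_weierstrassP_mul_eval_eq` with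
`σ = conj`), the reduced fraction has real coefficients, and `(f, g, c) = (P₀, ν²Q₀, ν)` as in the
`ℚ`-line's `DatumOfRatMult.stub_datumOfRatMult`. (For an imaginary multiplier `iν` the same gives a real
datum to the twist `(α', −β')`.) -/
theorem realDatum_of_real_multiplier (α β α' β' : ℝ) (hΔ : 4 * α ^ 3 + 27 * β ^ 2 ≠ 0)
    (hΔ' : 4 * α' ^ 3 + 27 * β' ^ 2 ≠ 0) (L L' : PeriodPair)
    (h₂ : L.g₂ = -4 * (α : ℂ)) (h₃ : L.g₃ = -4 * (β : ℂ)) (h₂' : L'.g₂ = -4 * (α' : ℂ))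
    (h₃' : L'.g₃ = -4 * (β' : ℂ)) (ν : ℝ) (hν : ν ≠ 0)
    (hmul : ∀ l ∈ L.lattice, (ν : ℂ) * l ∈ L'.lattice) :
    ∃ (f g : ℝ[X]) (c : ℝ), IsRealDatum α β α' β' f g c := by
  sorry

/-- **What the two cards deliver to `stub_algNormalForm`** (the statement that replaces "Galois descent
on Hom"): between real-algebraic nonsingular cubics whose lattices are isogenous over `ℂ` there is a
real-ALGEBRAIC datum to `E'` or to its `(−1)`-twist `(α', −β')`. -/
def AlgRealDatum : Prop :=
  ∀ (α β α' β' : ℝ), IsAlgebraic ℚ α → IsAlgebraic ℚ β → IsAlgebraic ℚ α' → IsAlgebraic ℚ β' →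
    4 * α ^ 3 + 27 * β ^ 2 ≠ 0 → 4 * α' ^ 3 + 27 * β' ^ 2 ≠ 0 →
    ∀ (L L' : PeriodPair), L.g₂ = -4 * (α : ℂ) → L.g₃ = -4 * (β : ℂ) → L'.g₂ = -4 * (α' : ℂ) →
      L'.g₃ = -4 * (β' : ℂ) → L.IsIsogenousTo L' →
      ∃ (f g : ℝ[X]) (c : ℝ), (∀ i, IsAlgebraic ℚ (f.coeff i)) ∧ (∀ i, IsAlgebraic ℚ (g.coeff i)) ∧
        IsAlgebraic ℚ c ∧ (IsRealDatum α β α' β' f g c ∨ IsRealDatum α β α' (-β') f g c)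

/-- The assembly of the two cards into `AlgRealDatum` (modulo the two statements above and the
realness of the lattices with real invariants, `PeriodPair.IsReal`): kernel-checked shape. -/
theorem algRealDatum_of
    (hreal : ∀ (L : PeriodPair), (L.g₂).im = 0 → (L.g₃).im = 0 → L.IsReal)
    (hR : ∀ (α β α' β' : ℝ), 4 * α ^ 3 + 27 * β ^ 2 ≠ 0 → 4 * α' ^ 3 + 27 * β' ^ 2 ≠ 0 →
      ∀ (L L' : PeriodPair), L.g₂ = -4 * (α : ℂ) → L.g₃ = -4 * (β : ℂ) → L'.g₂ = -4 * (α' : ℂ) →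
        L'.g₃ = -4 * (β' : ℂ) → ∀ ν : ℝ, ν ≠ 0 →
        ((∀ l ∈ L.lattice, (ν : ℂ) * l ∈ L'.lattice) → ∃ (f g : ℝ[X]) (c : ℝ), IsRealDatum α β α' β' f g c) ∧
        ((∀ l ∈ L.lattice, (ν : ℂ) * I * l ∈ L'.lattice) →
          ∃ (f g : ℝ[X]) (c : ℝ), IsRealDatum α β α' (-β') f g c))
    (hT : ∀ (α β α' β' : ℝ), IsAlgebraic ℚ α → IsAlgebraic ℚ β → IsAlgebraic ℚ α' → IsAlgebraic ℚ β' →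
      (∃ (f g : ℝ[X]) (c : ℝ), IsRealDatum α β α' β' f g c) →
      ∃ (f g : ℝ[X]) (c : ℝ), (∀ i, IsAlgebraic ℚ (f.coeff i)) ∧ (∀ i, IsAlgebraic ℚ (g.coeff i)) ∧
        IsAlgebraic ℚ c ∧ IsRealDatum α β α' β' f g c) :
    AlgRealDatum := by
  intro α β α' β' hα hβ hα' hβ' hΔ hΔ' L L' h₂ h₃ h₂' h₃' hiso
  have hL : L.IsReal := hreal L (by rw [h₂]; simp) (by rw [h₃]; simp)
  have hL' : L'.IsReal := hreal L' (by rw [h₂']; simp) (by rw [h₃']; simp)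
  obtain ⟨ν, hν, hcase⟩ := conjSymm_multiplier L L' hL hL' hiso
  obtain ⟨hR1, hR2⟩ := hR α β α' β' hΔ hΔ' L L' h₂ h₃ h₂' h₃' ν hν
  rcases hcase with hre | him
  · obtain ⟨f, g, c, hf, hg, hc, hd⟩ := hT α β α' β' hα hβ hα' hβ' (hR1 hre)
    exact ⟨f, g, c, hf, hg, hc, Or.inl hd⟩
  · obtain ⟨f, g, c, hf, hg, hc, hd⟩ := hT α β α' (-β') hα hβ hα' hβ'.neg (hR2 him)
    exact ⟨f, g, c, hf, hg, hc, Or.inr hd⟩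

/-! ### Card `laurent-suplattice-descent` -/

/-- **First lemma of card `laurent-suplattice-descent`**: a lattice CONTAINING a lattice with algebraic
invariants has algebraic invariants — Laurent comparison at `z = 0` of the transformation of order `n`
(`PeriodPair.iteratedDeriv_weierstrassPExcept_sub_of_transformation`: the Taylor coefficients of
`℘_{Λ'} − ℘_Λ` at `0` are `Σ_{c ∈ S∖0} ℘_Λ⁽ⁿ⁾(−c)`), `℘'' = 6℘² − g₂/2`, `℘⁽⁴⁾ = 120℘³ − 18g₂℘ − 12g₃`,
and the algebraicity of division values (`PeriodPair.isAlgebraic_weierstrassP_of_torsion`). -/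
theorem suplattice_isAlgebraic (L L' : PeriodPair) (hle : L.lattice ≤ L'.lattice)
    (h₂ : IsAlgebraic ℚ L.g₂) (h₃ : IsAlgebraic ℚ L.g₃) :
    IsAlgebraic ℚ L'.g₂ ∧ IsAlgebraic ℚ L'.g₃ := by
  sorry

/-- Corollary aimed at: a non-zero multiplier between lattices with algebraic invariants is algebraic
(apply `suplattice_isAlgebraic` to `Λ ⊆ μ⁻¹Λ'`, whose invariants are `μ⁴g₂'`, `μ⁶g₃'`, not both `g₂', g₃'`
zero). This is what lets the tree's `Aut(ℂ/F)`-descent (`Complex.mem_subfield_of_forall_ringEquiv`,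
`PeriodPair.map_mul_eq_mul_map_of_weierstrassP_mul_eval_eq`) run one field up. -/
theorem multiplier_isAlgebraic (L L' : PeriodPair) (h₂ : IsAlgebraic ℚ L.g₂) (h₃ : IsAlgebraic ℚ L.g₃)
    (h₂' : IsAlgebraic ℚ L'.g₂) (h₃' : IsAlgebraic ℚ L'.g₃) (hΔ' : L'.g₂ ^ 3 - 27 * L'.g₃ ^ 2 ≠ 0)
    (μ : ℂ) (hμ : μ ≠ 0) (hmul : ∀ l ∈ L.lattice, μ * l ∈ L'.lattice) : IsAlgebraic ℚ μ := by
  sorry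

/-! ### The crux, by name (what every line must conclude):
`Summit.KontsevichZagierPeriods.KontsevichZagierPeriods.Theses.IsogenyCertificates.AlgebraicModuliRealPeriodCell`
(route file import dropped in this published copy so that the workfile elaborates independently of route-file rewrites). -/

end Summit.KontsevichZagierPeriods.KontsevichZagierPeriods.Cruxes.AlgebraicModuliRealPeriodCell.Ideator1
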